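import Literature.MathematicalPhysics.QuantumLattice.VariationalEquilibriumStability
import Literature.MathematicalPhysics.QuantumLattice.VariationalEquilibriumExistence
import Literature.MathematicalPhysics.QuantumLattice.TIStateMeanEntropy
import HarnessLib

/-!
# Israel's tangent theorem along a coupling direction: every subgradient of the variational pressure is the conjugate
# density of an equilibrium state (every finite-range lattice-fermion family on `ℤ^d`)

Topic `MathematicalPhysics/QuantumLattice` (family `hubbard`, but model-free; stage S2 (ii)/(iii) «families of models, T > 0»).
Sequel of `TIVariationalPressure` (variational pressure `P(β,Ψ) = sup_TI[s̄ − βe_Ψ]`, equilibria `IsVarEquilibrium`, the Griffiths/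
Bogoliubov bracket `P(θ) − βδ e_a(ω) ≤ P(θ + δ1_a)` along a linear family `Ψ(θ) = Ψ₀ + Σ θ_aΨ_a`), `VariationalEquilibriumExistence`
(equilibria exist; weak-⋆ limits of maximising sequences are equilibria), `VariationalEquilibriumStability`, `TIStateMeanEntropy`
(mixtures of equilibria are equilibria).

**TANGENT REALISATION** (`d ≥ 1`, every real `β`, every direction `a` through every `θ`): the pressure `δ ↦ f(δ) = P(θ + δ1_a)` is
convex (`convexOn_varPressure_direction`); for EVERY subgradient `g` of `f` at `0` (`f(0) + gδ ≤ f(δ)` for all `δ`) there is a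
variational equilibrium state `ω` at `θ` with `β·e_{Ψ_a}(ω) = −g` (`exists_isVarEquilibrium_mul_meanEnergy_eq_of_subgradient`).
Proof: equilibria at `θ + s_k1_a` (`s_k = 1/(k+1)`) have `−βe_a ≥ q_k := (f(s_k) − f(0))/s_k` by the bracket, `q_k ↓ D₊ = inf_k q_k`;
a weak-⋆ limit point is an equilibrium at `θ` (the variational functional converges to `P(θ)` by the Lipschitz bound in the coupling)
with `−βe_a ≥ D₊`, and `≤ D₊` because `−βe_a` of an equilibrium is itself a subgradient
(`exists_isVarEquilibrium_neg_mul_meanEnergy_eq_ciInf`); the mirror image from the left gives `D₋ = sup_k (f(0) − f(−s_k))/s_k`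
(`…_eq_ciSup`); every subgradient lies in `[D₋, D₊]` and mixtures of the two equilibria interpolate. Conversely every equilibrium's
`−βe_a(ω)` is a subgradient (`IsVarEquilibrium.varPressure_sub_mul_le_update`), so **the conjugate densities of the equilibrium states
at `θ` fill exactly the subdifferential `[D₋, D₊]` of the pressure in the direction `a`** — the phase-coexistence interval of that
coupling. The 2D `t–t'` Hubbard instance (every filling is realised by a grand-canonical equilibrium; the canonical pressure in a
Zeeman field is the constrained variational pressure) is `HubbardTTPrimeThermalPressureZeemanStates`.

HONEST SCOPE: existence statements about infinite-volume variational equilibrium states; no uniqueness claim; no certificate; no phase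
word; no definition. Everything PROVED, 0 sorry.

## Mathlib / tree search
`lean search 'subgradient.*IsVarEquilibrium|tangent.*realis|isVarEquilibrium_of_tendsto_params'` (2026-08-28): only existence
(`exists_isVarEquilibrium`) and the window form (`exists_isVarEquilibrium_meanEnergy_mem_Icc`) — no realisation of a PRESCRIBED
subgradient. REUSED: `FermionInteraction.exists_isVarEquilibrium`, `InfVolFermionState.exists_tendsto_expect_subseq`,
`isVarEquilibrium_of_tendsto_expect_of_tendsto`, `tendsto_meanEnergy_of_tendsto_expect`, `IsVarEquilibrium.varPressure_sub_mul_le_update`,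
`IsVarEquilibrium.mix`, `meanEnergy_mix`, `convexOn_varPressure_linearFamily`, `abs_varPressure_linearFamily_sub_le`,
`meanEnergy_linearFamily_eq_add_sum_sub_mul`, `abs_meanEnergy_le_norm`; Mathlib `ConvexOn.secant_mono`, `tendsto_atTop_ciInf`,
`tendsto_atTop_ciSup`, `squeeze_zero_norm`, `tendsto_one_div_add_atTop_nhds_zero_nat`.

## References
* R. B. Israel, *Convexity in the Theory of Lattice Gases* (1979), Thm. I.2.4 and §V.1 (invariant equilibrium states are the tangent
  functionals to the pressure). [cite: Israel1979, Thm. I.2.4]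
* O. Bratteli, D. W. Robinson, *Operator Algebras and Quantum Statistical Mechanics II* (1997), Thm. 6.2.40. [cite: BratteliRobinsonII1997, Thm. 6.2.40]
* R. B. Griffiths, J. Math. Phys. 5 (1964) 1215, Appendix. [cite: Griffiths1964, Appendix]
-/

noncomputable section

namespace Literature.MathematicalPhysics.QuantumLattice

open _root_.Filter Set InfVolFermionState
open scoped _root_.Topology Matrix.Norms.L2Operator

/-! ### §1 Tangent realisation along one coupling direction -/

section Generic

variable {d : ℕ} (hd : 0 < d) {ι : Type*}

/-- `θ + 1_a·x + 1_a·y = θ + 1_a·(x + y)`. [folklore] -/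
private theorem add_single_add_single [DecidableEq ι] (θ : ι → ℝ) (a : ι) (x y : ℝ) :
    θ + Pi.single a x + Pi.single a y = θ + Pi.single a (x + y) := by
  rw [Pi.single_add, add_assoc]

variable [Fintype ι] [DecidableEq ι] (β : ℝ) (Ψ₀ : FermionInteraction d) (Ψv : ι → FermionInteraction d) (R : ℝ) (θ : ι → ℝ) (a : ι)

/-- **Convexity of the pressure along one coupling direction**: `δ ↦ P(θ + δ1_a)` is convex on `ℝ`. [cite: Israel1979, Thm. I.2.4] -/
theorem convexOn_varPressure_direction :
    ConvexOn ℝ Set.univ fun δ : ℝ => (FermionInteraction.linearFamily Ψ₀ Ψv (θ + Pi.single a δ)).varPressure β R := by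
  refine ⟨convex_univ, fun x _ y _ p q hp hq hpq => ?_⟩
  have h := (convexOn_varPressure_linearFamily Ψ₀ Ψv β R).2 (Set.mem_univ (θ + Pi.single a x)) (Set.mem_univ (θ + Pi.single a y))
    hp hq hpq
  have e : p • (θ + Pi.single a x) + q • (θ + Pi.single a y) = θ + Pi.single a (p • x + q • y) := by
    ext i
    simp only [Pi.add_apply, Pi.smul_apply, smul_eq_mul, Pi.single_apply]
    split_ifs
    · have : p * θ i + q * θ i = θ i := by rw [← add_mul, hpq, one_mul]
      linarith
    · have : p * θ i + q * θ i = θ i := by rw [← add_mul, hpq, one_mul]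
      linarith
  rw [e] at h
  exact h

/-- `Σ_b ((θ + x1_a) b − θ b)·g b = x·g a`. [folklore] -/
private theorem sum_single_shift_mul (x : ℝ) (g : ι → ℝ) :
    ∑ b : ι, ((θ + Pi.single a x : ι → ℝ) b - θ b) * g b = x * g a := by
  simp only [Pi.add_apply, add_sub_cancel_left]
  rw [Finset.sum_eq_single a]
  · rw [Pi.single_eq_same]
  · intro b _ hb; rw [Pi.single_eq_of_ne hb, zero_mul]
  · intro ha; exact absurd (Finset.mem_univ a) ha

/-- `Σ_b |(θ + x1_a) b − θ b|·g b = |x|·g a`. [folklore] -/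
private theorem sum_abs_single_shift_mul (x : ℝ) (g : ι → ℝ) :
    ∑ b : ι, |(θ + Pi.single a x : ι → ℝ) b - θ b| * g b = |x| * g a := by
  simp only [Pi.add_apply, add_sub_cancel_left]
  rw [Finset.sum_eq_single a]
  · rw [Pi.single_eq_same]
  · intro b _ hb; rw [Pi.single_eq_of_ne hb, abs_zero, zero_mul]
  · intro ha; exact absurd (Finset.mem_univ a) ha

include hd

/-- **The one-sided limit of equilibria from the RIGHT realises the right derivative.** With `s_k = 1/(k+1)`, `q_k = (f(s_k) − f(0))/s_k`
(`f(δ) = P(θ + δ1_a)`; `q` antitone, bounded below), there is an equilibrium `ω` at `θ` with `−β e_a(ω) = inf_k q_k`.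
[cite: Israel1979, Thm. I.2.4] -/
theorem exists_isVarEquilibrium_neg_mul_meanEnergy_eq_ciInf :
    ∃ ω : InfVolFermionState d, ω.IsVarEquilibrium β (FermionInteraction.linearFamily Ψ₀ Ψv θ) R ∧
      -(β * ω.meanEnergy (Ψv a) R) = ⨅ k : ℕ, ((FermionInteraction.linearFamily Ψ₀ Ψv (θ + Pi.single a (1 / ((k : ℝ) + 1)))).varPressure β R -
        (FermionInteraction.linearFamily Ψ₀ Ψv θ).varPressure β R) / (1 / ((k : ℝ) + 1)) := by
  -- the pressure along the direction `a`, as a function of one real variable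
  let f : ℝ → ℝ := fun δ => (FermionInteraction.linearFamily Ψ₀ Ψv (θ + Pi.single a δ)).varPressure β R
  have hfapp : ∀ δ, f δ = (FermionInteraction.linearFamily Ψ₀ Ψv (θ + Pi.single a δ)).varPressure β R := fun _ => rfl
  have hf0 : f 0 = (FermionInteraction.linearFamily Ψ₀ Ψv θ).varPressure β R := by
    rw [hfapp, Pi.single_zero, add_zero]
  have hconv : ConvexOn ℝ Set.univ f := convexOn_varPressure_direction β Ψ₀ Ψv R θ a
  have hsec : ∀ x y : ℝ, x ≠ 0 → y ≠ 0 → x ≤ y → (f x - f 0) / x ≤ (f y - f 0) / y := by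
    intro x y hx hy hxy
    have h := hconv.secant_mono (a := 0) (x := x) (y := y) (mem_univ _) (mem_univ _) (mem_univ _) hx hy hxy
    rwa [sub_zero, sub_zero] at h
  have hs0 : ∀ k : ℕ, (0 : ℝ) < 1 / ((k : ℝ) + 1) := fun k => by positivity
  -- the right quotients `q`
  let q : ℕ → ℝ := fun k => (f (1 / ((k : ℝ) + 1)) - f 0) / (1 / ((k : ℝ) + 1))
  have hqapp : ∀ k, q k = (f (1 / ((k : ℝ) + 1)) - f 0) / (1 / ((k : ℝ) + 1)) := fun _ => rfl
  have hq_anti : Antitone q := by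
    intro k k' hkk'
    rw [hqapp, hqapp]
    exact hsec _ _ (hs0 k').ne' (hs0 k).ne'
      (one_div_le_one_div_of_le (by positivity) (by exact_mod_cast Nat.add_le_add_right hkk' 1))
  have hq_bdd : BddBelow (Set.range q) := by
    refine ⟨(f (-1) - f 0) / (-1), ?_⟩
    rintro _ ⟨k, rfl⟩
    rw [hqapp]
    exact hsec _ _ (by norm_num) (hs0 k).ne' (by linarith [hs0 k])
  have hq_tend : Tendsto q atTop (𝓝 (⨅ k, q k)) := tendsto_atTop_ciInf hq_anti hq_bdd
  -- equilibria at `θ + s_k 1_a`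
  have hex := fun k : ℕ =>
    FermionInteraction.exists_isVarEquilibrium hd β (FermionInteraction.linearFamily Ψ₀ Ψv (θ + Pi.single a (1 / ((k : ℝ) + 1)))) R
  choose ωs hωs using hex
  -- the bracket at `θ_k` with shift `−s_k` lands at `θ`: `q_k ≤ −β e_a(ω_k)`
  have hlow : ∀ k, q k ≤ -(β * (ωs k).meanEnergy (Ψv a) R) := by
    intro k
    have h := (hωs k).varPressure_sub_mul_le_update a (-(1 / ((k : ℝ) + 1)))
    rw [add_single_add_single θ a, add_neg_cancel, Pi.single_zero, add_zero] at h
    rw [hqapp, div_le_iff₀ (hs0 k), hfapp, hf0]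
    linarith [h]
  -- weak-⋆ limit point, an equilibrium at `θ`
  obtain ⟨φ, hφ, ωl, hlim⟩ := InfVolFermionState.exists_tendsto_expect_subseq ωs
  have heq : ωl.IsVarEquilibrium β (FermionInteraction.linearFamily Ψ₀ Ψv θ) R := by
    -- the shift sequence and its size
    have hsz : Tendsto (fun j : ℕ => |β| * ((1 / (((φ j : ℕ) : ℝ) + 1)) * ‖(Ψv a).meanEnergyObs R‖)) atTop (𝓝 0) := by
      have h0 : Tendsto (fun j : ℕ => 1 / (((φ j : ℕ) : ℝ) + 1)) atTop (𝓝 0) :=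
        (tendsto_one_div_add_atTop_nhds_zero_nat (𝕜 := ℝ)).comp hφ.tendsto_atTop
      have h := (h0.mul_const ‖(Ψv a).meanEnergyObs R‖).const_mul |β|
      rw [zero_mul, mul_zero] at h
      exact h
    -- pressures along the sequence converge (Lipschitz in the coupling)
    have hPj : Tendsto (fun j => f (1 / (((φ j : ℕ) : ℝ) + 1))) atTop (𝓝 (f 0)) := by
      refine tendsto_sub_nhds_zero_iff.1 (squeeze_zero_norm (fun j => ?_) hsz)
      have h := abs_varPressure_linearFamily_sub_le Ψ₀ Ψv β R (θ + Pi.single a (1 / (((φ j : ℕ) : ℝ) + 1))) θ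
      rw [sum_abs_single_shift_mul θ a] at h
      rw [Real.norm_eq_abs, hf0, hfapp]
      refine h.trans (le_of_eq ?_)
      rw [abs_of_pos (hs0 (φ j))]
    -- the variational functional at `θ` along the sequence
    have hid : ∀ j, (ωs (φ j)).entropyDensitySup - β * (ωs (φ j)).meanEnergy (FermionInteraction.linearFamily Ψ₀ Ψv θ) R =
        f (1 / (((φ j : ℕ) : ℝ) + 1)) + β * ((1 / (((φ j : ℕ) : ℝ) + 1)) * (ωs (φ j)).meanEnergy (Ψv a) R) := by
      intro j
      have h2 := (hωs (φ j)).2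
      have h3 := (ωs (φ j)).meanEnergy_linearFamily_eq_add_sum_sub_mul Ψ₀ Ψv (θ + Pi.single a (1 / (((φ j : ℕ) : ℝ) + 1))) θ R
      rw [sum_single_shift_mul θ a] at h3
      rw [hfapp, ← h2, h3]
      ring
    have h0 : Tendsto (fun j => β * ((1 / (((φ j : ℕ) : ℝ) + 1)) * (ωs (φ j)).meanEnergy (Ψv a) R)) atTop (𝓝 0) := by
      refine squeeze_zero_norm (fun j => ?_) hsz
      rw [Real.norm_eq_abs, abs_mul, abs_mul]
      refine mul_le_mul_of_nonneg_left ?_ (abs_nonneg _)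
      rw [abs_of_pos (hs0 (φ j))]
      exact mul_le_mul_of_nonneg_left ((ωs (φ j)).abs_meanEnergy_le_norm (Ψv a) R) (hs0 (φ j)).le
    have hF : Tendsto (fun j => (ωs (φ j)).entropyDensitySup -
        β * (ωs (φ j)).meanEnergy (FermionInteraction.linearFamily Ψ₀ Ψv θ) R) atTop
        (𝓝 ((FermionInteraction.linearFamily Ψ₀ Ψv θ).varPressure β R)) := by
      simp only [hid]
      have h := hPj.add h0
      rw [hf0, add_zero] at h
      exact h
    exact isVarEquilibrium_of_tendsto_expect_of_tendsto hd hlim (fun j => (hωs (φ j)).1) hF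
  have he := tendsto_meanEnergy_of_tendsto_expect (ω := fun j => ωs (φ j)) (ωl := ωl) hlim (Ψv a) R
  have hinf : (⨅ k : ℕ, ((FermionInteraction.linearFamily Ψ₀ Ψv (θ + Pi.single a (1 / ((k : ℝ) + 1)))).varPressure β R -
      (FermionInteraction.linearFamily Ψ₀ Ψv θ).varPressure β R) / (1 / ((k : ℝ) + 1))) = ⨅ k, q k := by
    refine iInf_congr fun k => ?_
    rw [hqapp, hfapp, hf0]
  refine ⟨ωl, heq, ?_⟩
  rw [hinf]
  refine le_antisymm ?_ ?_
  · -- a subgradient at `θ` is below every right quotient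
    refine le_ciInf fun k => ?_
    have h := heq.varPressure_sub_mul_le_update a (1 / ((k : ℝ) + 1))
    rw [hqapp, le_div_iff₀ (hs0 k), hfapp, hf0]
    linarith [h]
  · -- pass to the limit in `q_{φ j} ≤ −β e_a(ω_{φ j})`
    have h1 : Tendsto (fun j => q (φ j)) atTop (𝓝 (⨅ k, q k)) := hq_tend.comp hφ.tendsto_atTop
    have h2 : Tendsto (fun j => -(β * (ωs (φ j)).meanEnergy (Ψv a) R)) atTop (𝓝 (-(β * ωl.meanEnergy (Ψv a) R))) :=
      (he.const_mul β).neg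
    exact le_of_tendsto_of_tendsto' h1 h2 fun j => hlow (φ j)

/-- **The one-sided limit of equilibria from the LEFT realises the left derivative**: with `p_k = (f(0) − f(−s_k))/s_k` (monotone,
bounded above) there is an equilibrium `ω` at `θ` with `−β e_a(ω) = sup_k p_k`. [cite: Israel1979, Thm. I.2.4] -/
theorem exists_isVarEquilibrium_neg_mul_meanEnergy_eq_ciSup :
    ∃ ω : InfVolFermionState d, ω.IsVarEquilibrium β (FermionInteraction.linearFamily Ψ₀ Ψv θ) R ∧
      -(β * ω.meanEnergy (Ψv a) R) = ⨆ k : ℕ, ((FermionInteraction.linearFamily Ψ₀ Ψv θ).varPressure β R -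
        (FermionInteraction.linearFamily Ψ₀ Ψv (θ + Pi.single a (-(1 / ((k : ℝ) + 1))))).varPressure β R) / (1 / ((k : ℝ) + 1)) := by
  let f : ℝ → ℝ := fun δ => (FermionInteraction.linearFamily Ψ₀ Ψv (θ + Pi.single a δ)).varPressure β R
  have hfapp : ∀ δ, f δ = (FermionInteraction.linearFamily Ψ₀ Ψv (θ + Pi.single a δ)).varPressure β R := fun _ => rfl
  have hf0 : f 0 = (FermionInteraction.linearFamily Ψ₀ Ψv θ).varPressure β R := by
    rw [hfapp, Pi.single_zero, add_zero]
  have hconv : ConvexOn ℝ Set.univ f := convexOn_varPressure_direction β Ψ₀ Ψv R θ a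
  have hsec : ∀ x y : ℝ, x ≠ 0 → y ≠ 0 → x ≤ y → (f x - f 0) / x ≤ (f y - f 0) / y := by
    intro x y hx hy hxy
    have h := hconv.secant_mono (a := 0) (x := x) (y := y) (mem_univ _) (mem_univ _) (mem_univ _) hx hy hxy
    rwa [sub_zero, sub_zero] at h
  have hs0 : ∀ k : ℕ, (0 : ℝ) < 1 / ((k : ℝ) + 1) := fun k => by positivity
  -- the left quotients `p_k = (f 0 − f(−s_k))/s_k = (f(−s_k) − f 0)/(−s_k)`
  let p : ℕ → ℝ := fun k => (f (-(1 / ((k : ℝ) + 1))) - f 0) / (-(1 / ((k : ℝ) + 1)))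
  have hpapp : ∀ k, p k = (f (-(1 / ((k : ℝ) + 1))) - f 0) / (-(1 / ((k : ℝ) + 1))) := fun _ => rfl
  have hpapp' : ∀ k, p k = (f 0 - f (-(1 / ((k : ℝ) + 1)))) / (1 / ((k : ℝ) + 1)) := fun k => by
    have hk : (k : ℝ) + 1 ≠ 0 := by positivity
    rw [hpapp]
    field_simp
    ring
  have hp_mono : Monotone p := by
    intro k k' hkk'
    rw [hpapp, hpapp]
    have hss : 1 / ((k' : ℝ) + 1) ≤ 1 / ((k : ℝ) + 1) :=
      one_div_le_one_div_of_le (by positivity) (by exact_mod_cast Nat.add_le_add_right hkk' 1)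
    exact hsec _ _ (by linarith [hs0 k]) (by linarith [hs0 k']) (by linarith)
  have hp_bdd : BddAbove (Set.range p) := by
    refine ⟨(f 1 - f 0) / 1, ?_⟩
    rintro _ ⟨k, rfl⟩
    rw [hpapp]
    exact hsec _ _ (by linarith [hs0 k]) one_ne_zero (by linarith [hs0 k])
  have hp_tend : Tendsto p atTop (𝓝 (⨆ k, p k)) := tendsto_atTop_ciSup hp_mono hp_bdd
  have hex := fun k : ℕ =>
    FermionInteraction.exists_isVarEquilibrium hd β (FermionInteraction.linearFamily Ψ₀ Ψv (θ + Pi.single a (-(1 / ((k : ℝ) + 1))))) R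
  choose ωs hωs using hex
  -- the bracket at `θ_k` with shift `+s_k` lands at `θ`: `−β e_a(ω_k) ≤ p_k`
  have hup : ∀ k, -(β * (ωs k).meanEnergy (Ψv a) R) ≤ p k := by
    intro k
    have h := (hωs k).varPressure_sub_mul_le_update a (1 / ((k : ℝ) + 1))
    rw [add_single_add_single θ a, neg_add_cancel, Pi.single_zero, add_zero] at h
    rw [hpapp', le_div_iff₀ (hs0 k), hf0, hfapp]
    linarith [h]
  obtain ⟨φ, hφ, ωl, hlim⟩ := InfVolFermionState.exists_tendsto_expect_subseq ωs
  have heq : ωl.IsVarEquilibrium β (FermionInteraction.linearFamily Ψ₀ Ψv θ) R := by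
    -- the shift sequence and its size
    have hsz : Tendsto (fun j : ℕ => |β| * ((1 / (((φ j : ℕ) : ℝ) + 1)) * ‖(Ψv a).meanEnergyObs R‖)) atTop (𝓝 0) := by
      have h0 : Tendsto (fun j : ℕ => 1 / (((φ j : ℕ) : ℝ) + 1)) atTop (𝓝 0) :=
        (tendsto_one_div_add_atTop_nhds_zero_nat (𝕜 := ℝ)).comp hφ.tendsto_atTop
      have h := (h0.mul_const ‖(Ψv a).meanEnergyObs R‖).const_mul |β|
      rw [zero_mul, mul_zero] at h
      exact h
    -- pressures along the sequence converge (Lipschitz in the coupling)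
    have hPj : Tendsto (fun j => f (-(1 / (((φ j : ℕ) : ℝ) + 1)))) atTop (𝓝 (f 0)) := by
      refine tendsto_sub_nhds_zero_iff.1 (squeeze_zero_norm (fun j => ?_) hsz)
      have h := abs_varPressure_linearFamily_sub_le Ψ₀ Ψv β R (θ + Pi.single a (-(1 / (((φ j : ℕ) : ℝ) + 1)))) θ
      rw [sum_abs_single_shift_mul θ a] at h
      rw [Real.norm_eq_abs, hf0, hfapp]
      refine h.trans (le_of_eq ?_)
      rw [abs_neg, abs_of_pos (hs0 (φ j))]
    -- the variational functional at `θ` along the sequence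
    have hid : ∀ j, (ωs (φ j)).entropyDensitySup - β * (ωs (φ j)).meanEnergy (FermionInteraction.linearFamily Ψ₀ Ψv θ) R =
        f (-(1 / (((φ j : ℕ) : ℝ) + 1))) + β * ((-(1 / (((φ j : ℕ) : ℝ) + 1))) * (ωs (φ j)).meanEnergy (Ψv a) R) := by
      intro j
      have h2 := (hωs (φ j)).2
      have h3 := (ωs (φ j)).meanEnergy_linearFamily_eq_add_sum_sub_mul Ψ₀ Ψv (θ + Pi.single a (-(1 / (((φ j : ℕ) : ℝ) + 1)))) θ R
      rw [sum_single_shift_mul θ a] at h3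
      rw [hfapp, ← h2, h3]
      ring
    have h0 : Tendsto (fun j => β * ((-(1 / (((φ j : ℕ) : ℝ) + 1))) * (ωs (φ j)).meanEnergy (Ψv a) R)) atTop (𝓝 0) := by
      refine squeeze_zero_norm (fun j => ?_) hsz
      rw [Real.norm_eq_abs, abs_mul, abs_mul]
      refine mul_le_mul_of_nonneg_left ?_ (abs_nonneg _)
      rw [abs_neg, abs_of_pos (hs0 (φ j))]
      exact mul_le_mul_of_nonneg_left ((ωs (φ j)).abs_meanEnergy_le_norm (Ψv a) R) (hs0 (φ j)).le
    have hF : Tendsto (fun j => (ωs (φ j)).entropyDensitySup -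
        β * (ωs (φ j)).meanEnergy (FermionInteraction.linearFamily Ψ₀ Ψv θ) R) atTop
        (𝓝 ((FermionInteraction.linearFamily Ψ₀ Ψv θ).varPressure β R)) := by
      simp only [hid]
      have h := hPj.add h0
      rw [hf0, add_zero] at h
      exact h
    exact isVarEquilibrium_of_tendsto_expect_of_tendsto hd hlim (fun j => (hωs (φ j)).1) hF
  have he := tendsto_meanEnergy_of_tendsto_expect (ω := fun j => ωs (φ j)) (ωl := ωl) hlim (Ψv a) R
  refine ⟨ωl, heq, ?_⟩
  -- rewrite the `⨆` of the statement as `⨆ k, p k`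
  have hsup : (⨆ k : ℕ, ((FermionInteraction.linearFamily Ψ₀ Ψv θ).varPressure β R -
      (FermionInteraction.linearFamily Ψ₀ Ψv (θ + Pi.single a (-(1 / ((k : ℝ) + 1))))).varPressure β R) / (1 / ((k : ℝ) + 1))) =
      ⨆ k, p k := by
    refine iSup_congr fun k => ?_
    rw [hpapp', hf0, hfapp]
  rw [hsup]
  refine le_antisymm ?_ ?_
  · have h1 : Tendsto (fun j => p (φ j)) atTop (𝓝 (⨆ k, p k)) := hp_tend.comp hφ.tendsto_atTop
    have h2 : Tendsto (fun j => -(β * (ωs (φ j)).meanEnergy (Ψv a) R)) atTop (𝓝 (-(β * ωl.meanEnergy (Ψv a) R))) :=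
      (he.const_mul β).neg
    exact le_of_tendsto_of_tendsto' h2 h1 fun j => hup (φ j)
  · -- a subgradient at `θ` is above every left quotient
    refine ciSup_le fun k => ?_
    have h := heq.varPressure_sub_mul_le_update a (-(1 / ((k : ℝ) + 1)))
    rw [hpapp', div_le_iff₀ (hs0 k), hf0, hfapp]
    linarith [h]

/-- **ISRAEL'S TANGENT THEOREM ALONG A COUPLING DIRECTION.** For every subgradient `g` at `0` of the convex function
`δ ↦ P(β, Ψ₀ + Σ θ_bΨ_b + δΨ_a)` — `P(θ) + gδ ≤ P(θ + δ1_a)` for all `δ` — there is a variational equilibrium state `ω` at `(β, Ψ(θ))` with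
`β·e_{Ψ_a}(ω) = −g` (`d ≥ 1`, every real `β`): the conjugate densities of the equilibrium states at `θ` fill the whole subdifferential
(the converse inclusion is `IsVarEquilibrium.varPressure_sub_mul_le_update`). [cite: Israel1979, Thm. I.2.4] -/
theorem exists_isVarEquilibrium_mul_meanEnergy_eq_of_subgradient {g : ℝ}
    (hg : ∀ δ : ℝ, (FermionInteraction.linearFamily Ψ₀ Ψv θ).varPressure β R + g * δ ≤
      (FermionInteraction.linearFamily Ψ₀ Ψv (θ + Pi.single a δ)).varPressure β R) :
    ∃ ω : InfVolFermionState d, ω.IsVarEquilibrium β (FermionInteraction.linearFamily Ψ₀ Ψv θ) R ∧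
      β * ω.meanEnergy (Ψv a) R = -g := by
  obtain ⟨ωp, hωp, hp⟩ := exists_isVarEquilibrium_neg_mul_meanEnergy_eq_ciInf hd β Ψ₀ Ψv R θ a
  obtain ⟨ωm, hωm, hm⟩ := exists_isVarEquilibrium_neg_mul_meanEnergy_eq_ciSup hd β Ψ₀ Ψv R θ a
  have hs0 : ∀ k : ℕ, (0 : ℝ) < 1 / ((k : ℝ) + 1) := fun k => by positivity
  -- `g ≤ D₊ = −β e_a(ω₊)` and `D₋ = −β e_a(ω₋) ≤ g`
  have hgDp : g ≤ -(β * ωp.meanEnergy (Ψv a) R) := by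
    rw [hp]
    refine le_ciInf fun k => ?_
    rw [le_div_iff₀ (hs0 k)]
    linarith [hg (1 / ((k : ℝ) + 1))]
  have hDmg : -(β * ωm.meanEnergy (Ψv a) R) ≤ g := by
    rw [hm]
    refine ciSup_le fun k => ?_
    rw [div_le_iff₀ (hs0 k)]
    linarith [hg (-(1 / ((k : ℝ) + 1)))]
  -- mix
  rcases eq_or_lt_of_le (hDmg.trans hgDp) with hEq | hlt
  · exact ⟨ωm, hωm, by linarith⟩
  · set Dp : ℝ := -(β * ωp.meanEnergy (Ψv a) R) with hDp
    set Dm : ℝ := -(β * ωm.meanEnergy (Ψv a) R) with hDm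
    set lam : ℝ := (Dp - g) / (Dp - Dm) with hlam
    have hden : 0 < Dp - Dm := by linarith
    have hl0 : 0 ≤ lam := by rw [hlam]; exact div_nonneg (by linarith) hden.le
    have hl1 : lam ≤ 1 := by rw [hlam, div_le_one hden]; linarith
    refine ⟨InfVolFermionState.mix lam hl0 hl1 ωm ωp, hωm.mix hd lam hl0 hl1 hωp, ?_⟩
    rw [InfVolFermionState.meanEnergy_mix]
    have key : lam * Dm + (1 - lam) * Dp = g := by
      rw [hlam]; field_simp; ring
    have e1 : β * ωm.meanEnergy (Ψv a) R = -Dm := by rw [hDm]; ring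
    have e2 : β * ωp.meanEnergy (Ψv a) R = -Dp := by rw [hDp]; ring
    calc β * (lam * ωm.meanEnergy (Ψv a) R + (1 - lam) * ωp.meanEnergy (Ψv a) R)
        = lam * (β * ωm.meanEnergy (Ψv a) R) + (1 - lam) * (β * ωp.meanEnergy (Ψv a) R) := by ring
      _ = -(lam * Dm + (1 - lam) * Dp) := by rw [e1, e2]; ring
      _ = -g := by rw [key]

end Generic

end Literature.MathematicalPhysics.QuantumLattice
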